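import Summits.QuantumAdvantage.QuantumAdvantage.Theorems.ScaleDialBA
import Summits.QuantumAdvantage.QuantumAdvantage.Theorems.WildDialDollA
import Summits.QuantumAdvantage.QuantumAdvantage.Theorems.SteerDialFold

/-! # ScaleDialB — part 2/2 (mechanical split for landing of `ScaleDialB`; content verbatim; scopes re-opened with their variables) -/

set_option linter.dupNamespace false
set_option linter.style.longLine false
noncomputable section
open scoped Classical

namespace Summit.QuantumAdvantage.QuantumAdvantage.Theorems.ScaleDial
open Finset
open Literature.Computability.QuantumComplexity Literature.Computability.QuantumComplexity.RingHLF
open Literature.Computability.MetaComplexity Literature.Computability.MetaComplexity.Smolensky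
open Summit.QuantumAdvantage.AdviceFreeQNC0
open Summit.QuantumAdvantage.QuantumAdvantage.Theorems.RingPeriodFold (cov covStrat covStrat_mem_lowDeg)
open Summit.QuantumAdvantage.QuantumAdvantage.Theses.ExactnessDial (NoPerfectOdd3 PolyLossOddU3 MassStep3u OddToAll3
  DPLift3 MultiRingBridge3 NoPerfectConst3)

section StitchCore
variable {m : ℕ}

/-- (C) inner-product counts (`dot2 v z = wtAnd v z % 2` definitionally). -/
theorem cnt_ext (hm : 2 ≤ m) (x v : Fin (m + 1) → Bool) (z' : Fin (m + 2) → Bool) :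
    ∃ M : ℕ, RingHLF.wtAnd (extV v) z' = M + (if v 0 = true ∧ z' (Fin.castSucc 0) = true then 1 else 0) +
        (if v (Fin.last m) = true ∧ z' (Fin.castSucc (Fin.last m)) = true then 1 else 0) +
        (if (xor (v (Fin.last m)) (v 0)) = true ∧ z' (Fin.last (m + 1)) = true then 1 else 0) ∧
      RingHLF.wtAnd v (yPull x z') = M +
        (if v 0 = true ∧ (xor (z' (Fin.castSucc 0)) (xor (z' (Fin.last (m + 1))) (x 0))) = true then 1 else 0) +
        (if v (Fin.last m) = true ∧
          (xor (z' (Fin.castSucc (Fin.last m))) (xor (z' (Fin.last (m + 1))) (x (Fin.last m)))) = true then 1 else 0) := by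
  refine ⟨∑ i ∈ ((univ : Finset (Fin (m + 1))).erase 0).erase (Fin.last m),
    (if v i = true ∧ z' (Fin.castSucc i) = true then 1 else 0), ?_, ?_⟩
  · unfold RingHLF.wtAnd
    rw [card_filter, Fin.sum_univ_castSucc]
    simp only [ext_castSucc, ext_last]
    rw [sum_peel (by omega) (fun i => if v i = true ∧ z' (Fin.castSucc i) = true then 1 else 0)]
    omega
  · unfold RingHLF.wtAnd
    rw [card_filter]
    rw [sum_peel (by omega) (fun i => if v i = true ∧ yPull x z' i = true then 1 else 0)]
    have hmid : ∑ i ∈ ((univ : Finset (Fin (m + 1))).erase 0).erase (Fin.last m),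
        (if v i = true ∧ yPull x z' i = true then 1 else 0) =
        ∑ i ∈ ((univ : Finset (Fin (m + 1))).erase 0).erase (Fin.last m),
          (if v i = true ∧ z' (Fin.castSucc i) = true then 1 else 0) := by
      refine sum_congr rfl fun i hi => ?_
      simp only [yPull, bdry_mid hi, Bool.false_and, Bool.xor_false]
    rw [hmid]
    simp only [yPull, bdry_zero, bdry_last, Bool.true_and]
    omega

/-- the Boolean bookkeeping of the stitch (128 cases, `decide`). -/
theorem stitch_table : ∀ v0 vL x0 xL z0 zL zN : Bool,
    ((if v0 = true ∧ z0 = true then 1 else 0) + (if vL = true ∧ zL = true then 1 else 0) +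
        (if (xor vL v0) = true ∧ zN = true then 1 else 0) +
        (if x0 = true ∧ v0 = true then 1 else 0) + (if xL = true ∧ vL = true then 1 else 0) : ℕ) % 2 =
      ((if v0 = true ∧ (xor z0 (xor zN x0)) = true then 1 else 0) +
        (if vL = true ∧ (xor zL (xor zN xL)) = true then 1 else 0) : ℕ) % 2 := by
  decide

/-- (S) the sign bit across the stitch, for kernel vectors: `ℓ'(v') ≡ ℓ(v) + x_0 v_0 + x_m v_m`. -/
theorem signBit_ext (hm : 2 ≤ m) {x v : Fin (m + 1) → Bool} (hv : RingHLF.InKernel x v) :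
    RingHLF.signBit (yLift x) (extV v) =
      (RingHLF.signBit x v + (if x 0 = true ∧ v 0 = true then 1 else 0) +
        (if x (Fin.last m) = true ∧ v (Fin.last m) = true then 1 else 0)) % 2 := by
  unfold RingHLF.signBit
  have hE := edgesIn_ext hm v
  have hW := wtAnd_ext hm x v
  obtain ⟨k, hk⟩ := Summit.QuantumAdvantage.QuantumAdvantage.Theorems.RingPeriodFold.wtAnd_even_of_inKernel x v hv
  revert hE hW hk
  generalize RingHLF.edgesIn (extV v) = E'
  generalize RingHLF.edgesIn v = E
  generalize RingHLF.wtAnd (yLift x) (extV v) = W'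
  generalize RingHLF.wtAnd x v = W
  cases x 0 <;> cases v 0 <;> cases x (Fin.last m) <;> cases v (Fin.last m) <;> simp <;> omega

/-- **THE TRANSFER across the stitch** for a kernel vector `v ∈ K(x)`. -/
theorem stitch_transfer (hm : 2 ≤ m) {x v : Fin (m + 1) → Bool} (hv : RingHLF.InKernel x v) (z' : Fin (m + 2) → Bool) :
    RingHLF.dot2 (extV v) z' = RingHLF.signBit (yLift x) (extV v) ↔ RingHLF.dot2 v (yPull x z') = RingHLF.signBit x v := by
  have hd1 : RingHLF.dot2 (extV v) z' = RingHLF.wtAnd (extV v) z' % 2 := rfl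
  have hd2 : RingHLF.dot2 v (yPull x z') = RingHLF.wtAnd v (yPull x z') % 2 := rfl
  rw [hd1, hd2, signBit_ext hm hv]
  obtain ⟨M, h1, h2⟩ := cnt_ext hm x v z'
  have ht := stitch_table (v 0) (v (Fin.last m)) (x 0) (x (Fin.last m)) (z' (Fin.castSucc 0))
    (z' (Fin.castSucc (Fin.last m))) (z' (Fin.last (m + 1)))
  have hs : RingHLF.signBit x v < 2 := Nat.mod_lt _ (by norm_num)
  rw [h1, h2]
  revert ht hs
  generalize RingHLF.signBit x v = s
  cases x 0 <;> cases v 0 <;> cases x (Fin.last m) <;> cases v (Fin.last m) <;>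
    cases z' (Fin.castSucc 0) <;> cases z' (Fin.castSucc (Fin.last m)) <;> cases z' (Fin.last (m + 1)) <;>
    simp <;> omega

/-- **THE STITCH LAW (local complementation at a `Y`-measured vertex), all `m ≥ 2`:**
`Rel_{C_{m+2}}(yLift x, z') ↔ Rel_{C_{m+1}}(x, yPull x z')`. -/
theorem rel_yLift_iff (hm : 2 ≤ m) (x : Fin (m + 1) → Bool) (z' : Fin (m + 2) → Bool) :
    RingHLF.Rel (yLift x) z' ↔ RingHLF.Rel x (yPull x z') := by
  constructor
  · intro h v hv
    exact (stitch_transfer hm hv z').1 (h (extV v) (inKernel_ext hm hv))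
  · intro h w hw
    have hv := inKernel_restr hm hw
    have h' := (stitch_transfer hm hv z').2 (h (restrV w) hv)
    rwa [ext_restr hm hw] at h'

/-- (Z) the stitch preserves the odd class: two flipped bases and one new `Y`. -/
theorem oddZeros_yLift_iff (hm : 1 ≤ m) (x : Fin (m + 1) → Bool) : OddZeros (yLift x) ↔ OddZeros x := by
  unfold OddZeros
  rw [card_filter, card_filter, Fin.sum_univ_castSucc]
  simp only [yLift_castSucc, yLift_last]
  rw [sum_peel hm (fun i => if (xor (x i) (bdry m i)) = false then 1 else 0),
    sum_peel hm (fun i => if x i = false then 1 else 0)]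
  have hmid : ∑ i ∈ ((univ : Finset (Fin (m + 1))).erase 0).erase (Fin.last m),
      (if (xor (x i) (bdry m i)) = false then 1 else 0) =
      ∑ i ∈ ((univ : Finset (Fin (m + 1))).erase 0).erase (Fin.last m), (if x i = false then 1 else 0) := by
    refine sum_congr rfl fun i hi => ?_
    rw [bdry_mid hi, Bool.xor_false]
  rw [hmid, bdry_zero, bdry_last]
  generalize ∑ i ∈ ((univ : Finset (Fin (m + 1))).erase 0).erase (Fin.last m), (if x i = false then 1 else 0) = M
  cases x 0 <;> cases x (Fin.last m) <;> simp


/-- ScaleDialB helper `ind_coord_eq_mono` (decomp-qadv land package; see the module docstring). -/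
theorem ind_coord_eq_mono {n : ℕ} (j : Fin n) :
    (fun u : Fin n → Bool => if u j = true then (1 : ZMod 3) else 0) = Smolensky.mono (ZMod 3) {j} := by
  funext u; rw [Smolensky.mono_apply]; simp

/-- ScaleDialB helper `ind_coord_mem_lowDeg` (decomp-qadv land package; see the module docstring). -/
theorem ind_coord_mem_lowDeg {n : ℕ} (j : Fin n) (d : ℕ) (hd : 1 ≤ d) :
    (fun u : Fin n → Bool => if u j = true then (1 : ZMod 3) else 0) ∈ Smolensky.lowDeg (ZMod 3) n d := by
  rw [ind_coord_eq_mono]; exact Smolensky.mono_mem_lowDeg (by simpa using hd)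

/-- ScaleDialB helper `ind_not_coord_mem_lowDeg` (decomp-qadv land package; see the module docstring). -/
theorem ind_not_coord_mem_lowDeg {n : ℕ} (j : Fin n) :
    (fun u : Fin n → Bool => if (!u j) = true then (1 : ZMod 3) else 0) ∈ Smolensky.lowDeg (ZMod 3) n 1 := by
  have h : (fun u : Fin n → Bool => if (!u j) = true then (1 : ZMod 3) else 0) = 1 - Smolensky.mono (ZMod 3) {j} := by
    funext u; rw [Pi.sub_apply, Smolensky.mono_apply, Pi.one_apply]
    simp only [Finset.mem_singleton, forall_eq]
    rcases Bool.eq_false_or_eq_true (u j) with hu | hu <;> simp [hu]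
  rw [h]; exact Submodule.sub_mem _ (Summit.QuantumAdvantage.QuantumAdvantage.Theorems.WildDialDoll.one_mem_lowDeg n 1) (Smolensky.mono_mem_lowDeg (by simp))

/-- the coordinates of `yLift` are variables, negated variables, or the constant `true`: all of degree `≤ 1`. -/
theorem yLift_coord_mem_lowDeg (b : Fin (m + 2)) :
    (fun u : Fin (m + 1) → Bool => if yLift u b = true then (1 : ZMod 3) else 0) ∈ Smolensky.lowDeg (ZMod 3) (m + 1) 1 := by
  by_cases hb : b.val < m + 1
  · simp only [yLift_apply_lt _ hb]
    cases hB : bdry m ⟨b.val, hb⟩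
    · simp only [Bool.xor_false]; exact ind_coord_mem_lowDeg _ 1 le_rfl
    · simp only [Bool.xor_true]; exact ind_not_coord_mem_lowDeg _
  · have hbv : b.val = m + 1 := by have := b.isLt; omega
    simp only [yLift_apply_eq _ hbv, if_true]
    exact Summit.QuantumAdvantage.QuantumAdvantage.Theorems.WildDialDoll.one_mem_lowDeg (m + 1) 1

end StitchCore

section FoldCore

/-! ### C2. The `00`-fold (two `X`-measured vertices deleted) — lens-1 g4 core, re-derived here
(HOME/decomp-qadv-lens-1/g4/FoldDial.lean §foldOne). -/

variable {n : ℕ}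

/-- Pad a pattern of `C_n` with `00` at positions `n, n+1`. -/
def pad (x : Fin n → Bool) : Fin (n + 2) → Bool := fun b => if h : b.val < n then x ⟨b.val, h⟩ else false

/-- Lift a kernel vector: the block carries `(v 0, v (n-1))`. -/
def lift (hn : 0 < n) (v : Fin n → Bool) : Fin (n + 2) → Bool :=
  fun b => if h : b.val < n then v ⟨b.val, h⟩ else if b.val = n then v ⟨0, hn⟩ else v ⟨n - 1, by omega⟩

/-- ScaleDialB helper `pad_apply_lt` (decomp-qadv land package; see the module docstring). -/
theorem pad_apply_lt (x : Fin n → Bool) {b : Fin (n + 2)} (h : b.val < n) : pad x b = x ⟨b.val, h⟩ := by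
  simp [pad, h]

/-- ScaleDialB helper `pad_apply_ge` (decomp-qadv land package; see the module docstring). -/
theorem pad_apply_ge (x : Fin n → Bool) {b : Fin (n + 2)} (h : n ≤ b.val) : pad x b = false := by
  simp [pad, not_lt.2 h]

/-- ScaleDialB helper `lift_apply_lt` (decomp-qadv land package; see the module docstring). -/
theorem lift_apply_lt (hn : 0 < n) (v : Fin n → Bool) {b : Fin (n + 2)} (h : b.val < n) :
    lift hn v b = v ⟨b.val, h⟩ := by
  simp [lift, h]

/-- ScaleDialB helper `lift_apply_n` (decomp-qadv land package; see the module docstring). -/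
theorem lift_apply_n (hn : 0 < n) (v : Fin n → Bool) {b : Fin (n + 2)} (h : b.val = n) :
    lift hn v b = v ⟨0, hn⟩ := by
  simp [lift, h]

/-- ScaleDialB helper `lift_apply_n1` (decomp-qadv land package; see the module docstring). -/
theorem lift_apply_n1 (hn : 0 < n) (v : Fin n → Bool) {b : Fin (n + 2)} (h : b.val = n + 1) :
    lift hn v b = v ⟨n - 1, by omega⟩ := by
  simp [lift, h]

/-- ScaleDialB helper `pad_castAdd` (decomp-qadv land package; see the module docstring). -/
theorem pad_castAdd (x : Fin n → Bool) (i : Fin n) : pad x (Fin.castAdd 2 i) = x i := by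
  rw [pad_apply_lt x (by simp [i.isLt])]
  congr 1

/-- ScaleDialB helper `pad_natAdd` (decomp-qadv land package; see the module docstring). -/
theorem pad_natAdd (x : Fin n → Bool) (j : Fin 2) : pad x (Fin.natAdd n j) = false :=
  pad_apply_ge x (by simp)

/-- ScaleDialB helper `lift_castAdd` (decomp-qadv land package; see the module docstring). -/
theorem lift_castAdd (hn : 0 < n) (v : Fin n → Bool) (i : Fin n) : lift hn v (Fin.castAdd 2 i) = v i := by
  rw [lift_apply_lt hn v (by simp [i.isLt])]
  congr 1

/-- ScaleDialB helper `lift_natAdd_zero` (decomp-qadv land package; see the module docstring). -/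
theorem lift_natAdd_zero (hn : 0 < n) (v : Fin n → Bool) : lift hn v (Fin.natAdd n (0 : Fin 2)) = v ⟨0, hn⟩ :=
  lift_apply_n hn v (by simp)

/-- ScaleDialB helper `lift_natAdd_one` (decomp-qadv land package; see the module docstring). -/
theorem lift_natAdd_one (hn : 0 < n) (v : Fin n → Bool) :
    lift hn v (Fin.natAdd n (1 : Fin 2)) = v ⟨n - 1, by omega⟩ :=
  lift_apply_n1 hn v (by simp)

/-- The coordinates of `pad` are variables or the constant `false`. -/
theorem pad_coord : ∀ i : Fin (n + 2), (∃ b, ∀ x : Fin n → Bool, pad x i = b) ∨ (∃ j, ∀ x : Fin n → Bool, pad x i = x j) := by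
  intro i
  by_cases h : i.val < n
  · exact Or.inr ⟨⟨i.val, h⟩, fun x => pad_apply_lt x h⟩
  · exact Or.inl ⟨false, fun x => pad_apply_ge x (not_lt.1 h)⟩

/-! ### Transport of `prv`/`nxt` through the lift at old positions -/

/-- ScaleDialB helper `lift_prv` (decomp-qadv land package; see the module docstring). -/
theorem lift_prv (hn : 2 ≤ n) (v : Fin n → Bool) (b : Fin (n + 2)) (hb : b.val < n) :
    lift (by omega) v (RingHLF.prv b) = v (RingHLF.prv ⟨b.val, hb⟩) := by
  by_cases h0 : b.val = 0
  · have h1 : (RingHLF.prv b).val = n + 1 := by rw [prv_val, if_pos h0]; omega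
    rw [lift_apply_n1 _ v h1]
    congr 1; apply Fin.ext; simp only [prv_val]; split_ifs; all_goals omega
  · have h1 : (RingHLF.prv b).val = b.val - 1 := by rw [prv_val, if_neg h0]
    rw [lift_apply_lt _ v (by omega : (RingHLF.prv b).val < n)]
    congr 1; apply Fin.ext; simp only [prv_val]; split_ifs; all_goals omega

/-- ScaleDialB helper `lift_nxt` (decomp-qadv land package; see the module docstring). -/
theorem lift_nxt (hn : 2 ≤ n) (v : Fin n → Bool) (b : Fin (n + 2)) (hb : b.val < n) :
    lift (by omega) v (RingHLF.nxt b) = v (RingHLF.nxt ⟨b.val, hb⟩) := by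
  by_cases h0 : b.val + 1 = n
  · have h1 : (RingHLF.nxt b).val = n := by rw [nxt_val, if_neg (by omega)]; omega
    rw [lift_apply_n _ v h1]
    congr 1; apply Fin.ext; simp only [nxt_val]; split_ifs; all_goals omega
  · have h1 : (RingHLF.nxt b).val = b.val + 1 := by rw [nxt_val, if_neg (by omega)]
    rw [lift_apply_lt _ v (by omega : (RingHLF.nxt b).val < n)]
    congr 1; apply Fin.ext; simp only [nxt_val]; split_ifs; all_goals omega

/-! ### (K) kernel vectors lift -/

/-- ScaleDialB helper `inKernel_lift` (decomp-qadv land package; see the module docstring). -/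
theorem inKernel_lift (hn : 2 ≤ n) {x v : Fin n → Bool} (h : RingHLF.InKernel x v) :
    RingHLF.InKernel (pad x) (lift (by omega) v) := by
  intro b
  by_cases hb : b.val < n
  · rw [lift_prv hn v b hb, lift_nxt hn v b hb, lift_apply_lt _ v hb, pad_apply_lt x hb]
    exact h ⟨b.val, hb⟩
  · rw [pad_apply_ge x (not_lt.1 hb), Bool.false_and, Bool.xor_false]
    have hb2 := b.isLt
    rcases (show b.val = n ∨ b.val = n + 1 by omega) with hbn | hbn
    · have hp : (RingHLF.prv b).val = n - 1 := by rw [prv_val, if_neg (by omega)]; omega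
      have hq : (RingHLF.nxt b).val = n + 1 := by rw [nxt_val, if_neg (by omega)]; omega
      rw [lift_apply_lt _ v (by omega : (RingHLF.prv b).val < n), lift_apply_n1 _ v hq]
      have : (⟨(RingHLF.prv b).val, by omega⟩ : Fin n) = ⟨n - 1, by omega⟩ := Fin.ext hp
      rw [this, Bool.xor_self]
    · have hp : (RingHLF.prv b).val = n := by rw [prv_val, if_neg (by omega)]; omega
      have hq : (RingHLF.nxt b).val = 0 := by rw [nxt_val, if_pos (by omega)]
      rw [lift_apply_n _ v hp, lift_apply_lt _ v (by omega : (RingHLF.nxt b).val < n)]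
      have : (⟨(RingHLF.nxt b).val, by omega⟩ : Fin n) = ⟨0, by omega⟩ := Fin.ext hq
      rw [this, Bool.xor_self]

/-! ### (Z) padding preserves the odd class -/

/-- ScaleDialB helper `card_filter_pad_false` (decomp-qadv land package; see the module docstring). -/
theorem card_filter_pad_false (x : Fin n → Bool) :
    (univ.filter fun b : Fin (n + 2) => pad x b = false).card = (univ.filter fun j : Fin n => x j = false).card + 2 := by
  rw [card_filter, card_filter, Fin.sum_univ_add, Fin.sum_univ_two]
  simp only [pad_castAdd, pad_natAdd]
  simp

/-- ScaleDialB helper `oddZeros_pad` (decomp-qadv land package; see the module docstring). -/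
theorem oddZeros_pad (x : Fin n → Bool) (hx : OddZeros x) : OddZeros (pad x) := by
  unfold OddZeros at hx ⊢
  rw [card_filter_pad_false]
  omega

/-! ### (S) the sign bit is unchanged -/

/-- ScaleDialB helper `edgesIn_lift` (decomp-qadv land package; see the module docstring). -/
theorem edgesIn_lift (hn : 2 ≤ n) (v : Fin n → Bool) :
    RingHLF.edgesIn (lift (by omega) v) = RingHLF.edgesIn v +
      ((if v ⟨0, by omega⟩ = true ∧ v ⟨n - 1, by omega⟩ = true then 1 else 0) +
       (if v ⟨n - 1, by omega⟩ = true ∧ v ⟨0, by omega⟩ = true then 1 else 0)) := by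
  unfold RingHLF.edgesIn
  rw [card_filter, card_filter, Fin.sum_univ_add, Fin.sum_univ_two]
  have h1 : ∀ i : Fin n, lift (by omega) v (RingHLF.nxt (Fin.castAdd 2 i)) = v (RingHLF.nxt i) := fun i => by
    rw [lift_nxt hn v _ (by simp [i.isLt])]
    congr 1
  have hN0 : lift (by omega) v (RingHLF.nxt (Fin.natAdd n (0 : Fin 2))) = v ⟨n - 1, by omega⟩ :=
    lift_apply_n1 _ v (by rw [nxt_val]; simp)
  have hq : (RingHLF.nxt (Fin.natAdd n (1 : Fin 2))).val = 0 := by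
    rw [nxt_val]
    split_ifs with h
    · rfl
    · simp at h
  have hN1 : lift (by omega) v (RingHLF.nxt (Fin.natAdd n (1 : Fin 2))) = v ⟨0, by omega⟩ :=
    (lift_apply_lt (by omega) v (by omega)).trans (by congr 1; exact Fin.ext hq)
  simp only [lift_castAdd, h1, lift_natAdd_zero, lift_natAdd_one, hN0, hN1]

/-- ScaleDialB helper `wtAnd_lift` (decomp-qadv land package; see the module docstring). -/
theorem wtAnd_lift (hn : 2 ≤ n) (x v : Fin n → Bool) :
    RingHLF.wtAnd (pad x) (lift (by omega) v) = RingHLF.wtAnd x v := by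
  unfold RingHLF.wtAnd
  rw [card_filter, card_filter, Fin.sum_univ_add, Fin.sum_univ_two]
  simp only [pad_castAdd, lift_castAdd, pad_natAdd]
  simp

/-- ScaleDialB helper `signBit_lift` (decomp-qadv land package; see the module docstring). -/
theorem signBit_lift (hn : 2 ≤ n) (x v : Fin n → Bool) :
    RingHLF.signBit (pad x) (lift (by omega) v) = RingHLF.signBit x v := by
  unfold RingHLF.signBit
  rw [edgesIn_lift hn, wtAnd_lift hn]
  split_ifs with h h' <;> first | omega | (exfalso; tauto)

/-! ### dot products regroup under the fold -/

/-- ScaleDialB helper `dot2_fold` (decomp-qadv land package; see the module docstring). -/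
theorem dot2_fold (hn : 2 ≤ n) (v : Fin n → Bool) (Zt : Fin (n + 2) → Bool) (z : Fin n → Bool)
    (hz : ∀ i : Fin n, z i = xor (Zt (Fin.castAdd 2 i))
      (if i.val = 0 then Zt (Fin.natAdd n (0 : Fin 2)) else if i.val = n - 1 then Zt (Fin.natAdd n (1 : Fin 2)) else false)) :
    RingHLF.dot2 v z = RingHLF.dot2 (lift (by omega) v) Zt := by
  unfold RingHLF.dot2
  rw [card_filter, card_filter, Fin.sum_univ_add, Fin.sum_univ_two]
  simp only [lift_castAdd, lift_natAdd_zero, lift_natAdd_one]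
  set i0 : Fin n := ⟨0, by omega⟩ with hi0
  set il : Fin n := ⟨n - 1, by omega⟩ with hil
  have hne : il ≠ i0 := by
    intro h; have := congrArg Fin.val h; simp [hi0, hil] at this; omega
  have hmem0 : i0 ∈ (univ : Finset (Fin n)) := mem_univ _
  have hmeml : il ∈ (univ : Finset (Fin n)).erase i0 := mem_erase.2 ⟨hne, mem_univ _⟩
  rw [← add_sum_erase _ _ hmem0, ← add_sum_erase _ _ hmeml]
  rw [← add_sum_erase _ _ hmem0, ← add_sum_erase _ _ hmeml]
  have hrest : ∑ i ∈ ((univ : Finset (Fin n)).erase i0).erase il, (if v i = true ∧ z i = true then 1 else 0) =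
      ∑ i ∈ ((univ : Finset (Fin n)).erase i0).erase il, (if v i = true ∧ Zt (Fin.castAdd 2 i) = true then 1 else 0) := by
    refine sum_congr rfl fun i hi => ?_
    have h1 : i ≠ il := (mem_erase.1 hi).1
    have h2 : i ≠ i0 := (mem_erase.1 (mem_erase.1 hi).2).1
    have h1' : i.val ≠ n - 1 := fun h => h1 (Fin.ext (by rw [h, hil]))
    have h2' : i.val ≠ 0 := fun h => h2 (Fin.ext (by rw [h, hi0]))
    rw [hz i, if_neg h2', if_neg h1', Bool.xor_false]
  have hz0 : z i0 = xor (Zt (Fin.castAdd 2 i0)) (Zt (Fin.natAdd n (0 : Fin 2))) := by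
    rw [hz i0, if_pos (by rw [hi0])]
  have hzl : z il = xor (Zt (Fin.castAdd 2 il)) (Zt (Fin.natAdd n (1 : Fin 2))) := by
    rw [hz il, if_neg (by rw [hil]; dsimp only; omega), if_pos (by rw [hil])]
  rw [hrest, hz0, hzl]
  have e0 := Summit.QuantumAdvantage.QuantumAdvantage.Theorems.SteerDial.ite_xor_split (v i0) (Zt (Fin.castAdd 2 i0)) (Zt (Fin.natAdd n (0 : Fin 2)))
  have el := Summit.QuantumAdvantage.QuantumAdvantage.Theorems.SteerDial.ite_xor_split (v il) (Zt (Fin.castAdd 2 il)) (Zt (Fin.natAdd n (1 : Fin 2)))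
  omega

end FoldCore

end Summit.QuantumAdvantage.QuantumAdvantage.Theorems.ScaleDial
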